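import Mathlib.Topology.Algebra.Module.Cardinality
import Literature.Probability.Percolation.OneArmSeriesTerms
import Literature.Probability.Percolation.OneArmRenewal
import HarnessLib

/-!
# LSW's renewal identity (2.10) for the series solution (proofs only)

Topic `Literature/Probability/Percolation`; family `crit-perc`. Def-free, fact-free. For the
explicit solution `u = lswHit κ` (`OneArmHittingPDEAnalytic`: `u(θ, t) = Σ_k γ_k e^{-λ_k t} φ_k(θ)`
for `t > 0`, `u = 1` for `t ≤ 0`) of the boundary problem of Lawler–Schramm–Werner, *One-arm exponent
for critical 2D percolation*, Electron. J. Probab. **7** (2002), paper no. 2, Lemma 2.2, we prove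
LSW's strong-Markov identity **(2.10)** along the radial Bessel process `Y = Y^θ` of (2.9)–(2.11)
(`RadialBessel*.lean`), with lifetime `T` and exit side `Y_T ∈ {0, 2π}`:

> `u(θ, t) = E^θ[u(Y_T, t - T)]`,  i.e.  `u(θ, t) = P^θ[Y_T = 0, T ≥ t] + E^θ[G(t - T); Y_T = 2π]`,

`G = u(2π, ·)` (`u(0, s) = 0` for `s > 0`, `u ≡ 1` for `s ≤ 0`), that is
`lswHit κ θ t = botST κ bottomDatum θ t + topST κ (lswHit κ (2π)) θ t` for every `θ ∈ (0, 2π)` and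
every real `t` (`lswHit_eq_botST_add_topST`), and
`lswHit κ θ t = renewalST κ bottomDatum (lswHit κ (2π)) θ t` on `[0, 2π] × ℝ` (`lswHit_eq_renewalST`):
**the series solution is the renewal extension of its own trace**. In LSW the identity (2.10) is
read off the percolation construction (Thm. 2.1 and the radial Loewner equation); here it is a
theorem about the explicit solution, proved by optional stopping — the uniqueness half of the
identification of LSW's hitting function with `u`.

Proof (`integral_lswSeries_stoppedProcess_eq` → `lswSeries_eq_integral_lt_lifetime` →
`lswHit_eq_botST_add_topST_of_null` → all `t`):
1. for a level `n` and `s < t`, optional stopping of EVERY eigenfunction martingale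
   `e^{λ_k (r ∧ σₙ)} φ_k(Y_{r ∧ σₙ})` at `r = s` (`integral_expClock_mul_eq_self`, `Λ φ_k + λ_k φ_k = 0`)
   and summation over `k` (domination `|γ_k e^{-λ_k r} φ_k| ≤ A (k+1) ρ₀^k` for `r ≥ t - s > 0`,
   `OneArmSeriesTerms`) give `u(θ, t) = E[u(Y_{s∧σₙ}, t - s∧σₙ)]`;
2. `n → ∞` (bounded convergence, `σₙ ↑ T`, exit dichotomy, `u(2δₙ, ·) → 0`, joint continuity of `u`
   at `θ = 2π`): `u(θ, t) = E[u(Y_s, t - s); s < T] + E[G(t - T); T ≤ s, Y_T = 2π]`;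
3. `s ↑ t` off the (countably many) atoms of the law of `T` (bounded convergence; the initial
   condition `u(·, r) → 1` as `r ↓ 0` locally uniformly in the interior, `lswSeries_init_tendsto_one`,
   and path continuity): `u(θ, t) = P[t ≤ T, Y_T = 0] + E[G(t - T); Y_T = 2π]`;
4. all `t > 0` by continuity in `t` of both sides along non-atomic times `t_j ↑ t`
   (`G` is continuous, `lswHit_two_pi_continuous`); `t ≤ 0` directly.

## References

* G. F. Lawler, O. Schramm, W. Werner, *One-arm exponent for critical 2D percolation*, Electron.
  J. Probab. 7 (2002), no. 2, §2: (2.9)–(2.11), (2.10), Lemma 2.2. [LawlerSchrammWernerEJP2002]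
* G. F. Lawler, *Conformally Invariant Processes in the Plane*, AMS (2005), §1.11, Lemma 1.31.
  [Lawler2005]

## Mathlib / tree

Tree: `integral_expClock_mul_eq_self`, `stoppedProcess_sleArgLevel_mem_Icc` (`RadialBesselSLE`),
`ae_sleLifetime_lt_top`, `tendsto_sleExitLevelReal`, exit values (`RadialBesselLifetime`),
`exitsTop_or_exitsBot`, `arg`, `arg_eq_argLevel`, `continuousOn_arg`, `arg_mem_Ioo`
(`RadialBesselExit`), `topST`, `botST`, `renewalST` (`RadialBesselRenewal`), `bottomDatum`
(`OneArmRenewal`); `lswSeries_eq_tsum`, `abs_lswTerm_le`, `lswSeries_init_tendsto_one`,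
`lswHit_two_pi_continuous`, `continuous_lswHit_of_pos` (`OneArmSeriesTerms`). Mathlib:
`hasSum_integral_of_summable_integral_norm`, `tendsto_integral_of_dominated_convergence`,
`Measure.countable_meas_pos_of_disjoint_iUnion`, `Set.Countable.dense_compl`.
-/

noncomputable section

open MeasureTheory Filter Topology Set
open scoped NNReal ENNReal

namespace Literature.Probability.Percolation

open Literature.Probability.RandomPlanarGeometry Literature.Probability.RandomPlanarGeometry.RadialLoewner
open Literature.Probability.Process Literature.Analysis.SpecialFunctions Literature.Analysis.FunctionSpaces

variable {κ : ℝ≥0} {n : ℕ} {θ : ℝ}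

/-! ### Step 1: optional stopping of all eigenfunction martingales at `s ∧ σₙ` -/

/-- A global `C²` function agreeing with `φ_k` on `[2δₙ, 2π - 2δₙ]`, with vanishing weighted
generator `Λ_{λ_k}` there. [folklore] -/
theorem exists_contDiff_lswEigenfun (hκ : 4 < κ) (n k : ℕ) :
    ∃ F : ℝ → ℝ, ContDiff ℝ 2 F ∧
      (∀ y ∈ Icc (2 * level n) (2 * Real.pi - 2 * level n), F y = lswEigenfun κ k y) ∧
      ∀ y ∈ Icc (2 * level n) (2 * Real.pi - 2 * level n), expGenerator κ (lswEigenvalue κ k) F y = 0 := by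
  have hκ' : (4 : ℝ) < κ := by exact_mod_cast hκ
  obtain ⟨F, hF, hFeq⟩ := exists_contDiff_eventuallyEq (contDiffOn_lswEigenfun (κ := (κ : ℝ)) k)
    (level_pos n) (level_lt_pi n)
  refine ⟨F, hF, fun y hy ↦ (hFeq y (Icc_level_subset_Ioo_level n hy)).eq_of_nhds, fun y hy ↦ ?_⟩
  rw [expGenerator_congr (hFeq y (Icc_level_subset_Ioo_level n hy))]
  exact lswOp_deriv_lswEigenfun hκ' k (Icc_level_subset_Ioo n hy)

/-- **`E[u(Y_{s∧σₙ}, t - s∧σₙ)] = u(θ, t)`** for a level `n` whose interval contains `θ` and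
`s < t` (`u = lswSeries κ (lswInitCoeff κ)`, `κ > 4`): every term `γ_k e^{-λ_k (t - s∧σₙ)} φ_k(Y_{s∧σₙ})`
integrates to `γ_k e^{-λ_k t} φ_k(θ)` (optional stopping of the eigenfunction martingale,
`integral_expClock_mul_eq_self`), and the series may be integrated termwise (domination by
`A (k+1) ρ₀^k`, `ρ₀ = e^{-(κ/8)(t - s)}`). [cite: LawlerSchrammWernerEJP2002, §2 (2.10) and proof of Lemma 2.2] -/
theorem integral_lswSeries_stoppedProcess_eq (hκ : 4 < κ)
    (hθn : θ ∈ Ioo (2 * level n) (2 * Real.pi - 2 * level n)) {t : ℝ} {s : ℝ≥0} (hst : (s : ℝ) < t) :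
    ∫ ω, lswSeries κ (lswInitCoeff κ) (stoppedProcess (sleArgLevel κ n θ) (sleExitLevel κ n θ) s ω)
        (t - (((min (s : WithTop ℝ≥0) (sleExitLevel κ n θ ω)).untopA : ℝ≥0) : ℝ)) ∂preWienerMeasure
      = lswSeries κ (lswInitCoeff κ) θ t := by
  haveI := isProbabilityMeasure_preWienerMeasure'
  have hκ' : (4 : ℝ) < κ := by exact_mod_cast hκ
  set V : (ℝ≥0 → ℝ) → ℝ := fun ω ↦ stoppedProcess (sleArgLevel κ n θ) (sleExitLevel κ n θ) s ω with hV
  set τ : (ℝ≥0 → ℝ) → ℝ := fun ω ↦ (((min (s : WithTop ℝ≥0) (sleExitLevel κ n θ ω)).untopA : ℝ≥0) : ℝ)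
    with hτ
  have hVmem : ∀ ω, V ω ∈ Icc 0 (2 * Real.pi) := fun ω ↦
    Icc_level_subset_Icc n (stoppedProcess_sleArgLevel_mem_Icc hθn s ω)
  have hτle : ∀ ω, τ ω ≤ s := fun ω ↦ by
    simp only [hτ]; exact_mod_cast untopA_min_le s (sleExitLevel κ n θ ω)
  have hts : 0 < t - s := sub_pos.2 hst
  -- measurability of `V` and `τ`
  have hσst : IsStoppingTime brownianFiltration (sleExitLevel κ n θ) := isStoppingTime_sleExitLevel κ n θ
  have hVm : Measurable V :=
    ((stronglyAdapted_stoppedProcess_sleArgLevel κ n θ hσst s).measurable).mono (brownianFiltration.le s)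
      le_rfl
  have hτm : Measurable τ :=
    measurable_coe_nnreal_real.comp ((measurable_untopA_min_sleExitLevel κ n θ s).mono
      (brownianFiltration.le s) le_rfl)
  -- the terms
  set f : ℕ → (ℝ≥0 → ℝ) → ℝ := fun k ω ↦ lswInitCoeff κ k *
    Real.exp (-(lswEigenvalue κ k * (t - τ ω))) * lswEigenfun κ k (V ω) with hf
  have hfm : ∀ k, Measurable (f k) := by
    intro k
    have hc : Continuous fun p : ℝ × ℝ ↦ lswInitCoeff κ k * Real.exp (-(lswEigenvalue κ k * (t - p.1)))
        * lswEigenfun κ k p.2 :=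
      (continuous_const.mul (Real.continuous_exp.comp (by fun_prop))).mul
        ((continuous_lswEigenfun hκ' k).comp continuous_snd)
    exact hc.measurable.comp (hτm.prodMk hVm)
  -- envelope and domination
  obtain ⟨A, -, hA⟩ := exists_bound_lswInitCoeff_mul_lswEigenfun hκ'
  have hbound : ∀ k ω, |f k ω| ≤ A * ((k : ℝ) + 1) ^ 1 * Real.exp (-(κ / 8 * (t - s))) ^ k :=
    fun k ω ↦ abs_lswTerm_le hκ' hA hts k (hVmem ω) (by linarith [hτle ω])
  have hfi : ∀ k, Integrable (f k) preWienerMeasure := fun k ↦ integrable_of_abs_le (hfm k) (hbound k)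
  have hsum : Summable fun k ↦ ∫ ω, ‖f k ω‖ ∂preWienerMeasure := by
    refine Summable.of_nonneg_of_le (fun k ↦ integral_nonneg fun ω ↦ norm_nonneg _)
      (fun k ↦ ?_) (summable_lswTerm_bound hκ' A hts)
    calc ∫ ω, ‖f k ω‖ ∂preWienerMeasure
        ≤ ∫ _ω, A * ((k : ℝ) + 1) ^ 1 * Real.exp (-(κ / 8 * (t - s))) ^ k ∂preWienerMeasure :=
          integral_mono (hfi k).norm (integrable_const _) fun ω ↦ by
            rw [Real.norm_eq_abs]; exact hbound k ω
      _ = _ := by simp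
  -- termwise integrals: optional stopping
  have hterm : ∀ k, ∫ ω, f k ω ∂preWienerMeasure =
      lswInitCoeff κ k * Real.exp (-(lswEigenvalue κ k * t)) * lswEigenfun κ k θ := by
    intro k
    obtain ⟨F, hF, hFval, hgen⟩ := exists_contDiff_lswEigenfun hκ n k
    have hos := integral_expClock_mul_eq_self hθn hF hgen s
    have hθmem : θ ∈ Icc (2 * level n) (2 * Real.pi - 2 * level n) := ⟨hθn.1.le, hθn.2.le⟩
    rw [hFval θ hθmem] at hos
    have heq : ∀ ω, f k ω = (lswInitCoeff κ k * Real.exp (-(lswEigenvalue κ k * t))) *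
        (expClock κ n θ (lswEigenvalue κ k) s ω *
          F (stoppedProcess (sleArgLevel κ n θ) (sleExitLevel κ n θ) s ω)) := by
      intro ω
      rw [expClock_apply, hFval _ (stoppedProcess_sleArgLevel_mem_Icc hθn s ω)]
      simp only [hf, hV, hτ]
      rw [show -(lswEigenvalue κ k * (t - (((min (s : WithTop ℝ≥0) (sleExitLevel κ n θ ω)).untopA
          : ℝ≥0) : ℝ))) = -(lswEigenvalue κ k * t) + lswEigenvalue κ k *
          (((min (s : WithTop ℝ≥0) (sleExitLevel κ n θ ω)).untopA : ℝ≥0) : ℝ) by ring, Real.exp_add]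
      ring
    simp_rw [heq]
    rw [MeasureTheory.integral_const_mul, hos]
  -- sum
  have hS := hasSum_integral_of_summable_integral_norm hfi hsum
  simp_rw [hterm] at hS
  have hlhs : ∀ ω, lswSeries κ (lswInitCoeff κ) (V ω) (t - τ ω) = ∑' k, f k ω := fun ω ↦
    lswSeries_eq_tsum (lswInitCoeff κ) (V ω) (t - τ ω)
  show ∫ ω, lswSeries κ (lswInitCoeff κ) (V ω) (t - τ ω) ∂preWienerMeasure = _
  simp_rw [hlhs]
  rw [← hS.tsum_eq, ← lswSeries_eq_tsum]

/-! ### Step 2: `n → ∞` -/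

/-- **`u(θ, t) = E[u(Y_s, t - s); s < T] + E[G(t - T); T ≤ s, Y_T = 2π]`** for `θ ∈ (0, 2π)`,
`0 ≤ s < t` (`u = lswHit κ`, `G = lswHit κ (2π)`): the limit `n → ∞` of
`integral_lswSeries_stoppedProcess_eq` (bounded convergence: on `{s < T}` the stopped flow is
eventually `Y_s` and the clock `s`; on `{T ≤ s}` the exit values tend to `2π` resp. `0` and the
clocks to `T`, while `u(2δₙ, ·) → 0` uniformly on `[t - s, ∞)` and `u` is jointly continuous at
`(2π, t - T)`). [cite: LawlerSchrammWernerEJP2002, §2 (2.10)] -/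
theorem lswSeries_eq_integral_lt_lifetime (hκ : 4 < κ) (hθ : θ ∈ Ioo 0 (2 * Real.pi)) {t : ℝ}
    {s : ℝ≥0} (hst : (s : ℝ) < t) :
    lswSeries κ (lswInitCoeff κ) θ t = ∫ ω,
      (if (s : WithTop ℝ≥0) < sleLifetime κ θ ω then
          lswHit κ (arg (sleDriving κ) (continuous_sleDriving' κ) θ s ω) (t - s)
        else (sleExitsTop κ θ).indicator (fun ω ↦ lswHit κ (2 * Real.pi) (t - sleLifetimeReal κ θ ω)) ω)
      ∂preWienerMeasure := by
  haveI := isProbabilityMeasure_preWienerMeasure'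
  have hκ' : (4 : ℝ) < κ := by exact_mod_cast hκ
  have hc := continuous_sleDriving' κ
  have hts : 0 < t - s := sub_pos.2 hst
  obtain ⟨N₀, hN₀⟩ := eventually_mem_Ioo_level hθ
  -- the level-`(m + N₀)` observables
  set g : ℕ → (ℝ≥0 → ℝ) → ℝ := fun m ω ↦ lswSeries κ (lswInitCoeff κ)
    (stoppedProcess (sleArgLevel κ (m + N₀) θ) (sleExitLevel κ (m + N₀) θ) s ω)
    (t - (((min (s : WithTop ℝ≥0) (sleExitLevel κ (m + N₀) θ ω)).untopA : ℝ≥0) : ℝ)) with hg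
  have hint : ∀ m, ∫ ω, g m ω ∂preWienerMeasure = lswSeries κ (lswInitCoeff κ) θ t := fun m ↦
    integral_lswSeries_stoppedProcess_eq hκ (hN₀ (m + N₀) (Nat.le_add_left _ _)) hst
  have hmemV : ∀ m ω, stoppedProcess (sleArgLevel κ (m + N₀) θ) (sleExitLevel κ (m + N₀) θ) s ω ∈
      Icc 0 (2 * Real.pi) := fun m ω ↦
    Icc_level_subset_Icc _ (stoppedProcess_sleArgLevel_mem_Icc (hN₀ (m + N₀) (Nat.le_add_left _ _)) s ω)
  have hτle : ∀ m ω, (((min (s : WithTop ℝ≥0) (sleExitLevel κ (m + N₀) θ ω)).untopA : ℝ≥0) : ℝ) ≤ s :=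
    fun m ω ↦ by exact_mod_cast untopA_min_le s (sleExitLevel κ (m + N₀) θ ω)
  -- `g m = lswHit κ V (t - τ)` (clamp inactive), measurable by continuity of `lswHit` in `θ`? No:
  -- the time argument varies with `ω`; use joint measurability via `lswHit κ V r = u(V, r)` and the
  -- term series as in Step 1.
  have hmeas : ∀ m, AEStronglyMeasurable (g m) preWienerMeasure := by
    intro m
    set n := m + N₀
    have hσst : IsStoppingTime brownianFiltration (sleExitLevel κ n θ) := isStoppingTime_sleExitLevel κ n θ
    have hVm : Measurable fun ω ↦ stoppedProcess (sleArgLevel κ n θ) (sleExitLevel κ n θ) s ω :=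
      ((stronglyAdapted_stoppedProcess_sleArgLevel κ n θ hσst s).measurable).mono (brownianFiltration.le s)
        le_rfl
    have hτm : Measurable fun ω ↦ (((min (s : WithTop ℝ≥0) (sleExitLevel κ n θ ω)).untopA : ℝ≥0) : ℝ) :=
      measurable_coe_nnreal_real.comp ((measurable_untopA_min_sleExitLevel κ n θ s).mono
        (brownianFiltration.le s) le_rfl)
    have hterm : ∀ k, Measurable fun ω ↦ lswInitCoeff κ k *
        Real.exp (-(lswEigenvalue κ k * (t - (((min (s : WithTop ℝ≥0) (sleExitLevel κ n θ ω)).untopA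
          : ℝ≥0) : ℝ)))) * lswEigenfun κ k (stoppedProcess (sleArgLevel κ n θ) (sleExitLevel κ n θ) s ω) := by
      intro k
      have hcts : Continuous fun p : ℝ × ℝ ↦ lswInitCoeff κ k * Real.exp (-(lswEigenvalue κ k * (t - p.1)))
          * lswEigenfun κ k p.2 :=
        (continuous_const.mul (Real.continuous_exp.comp (by fun_prop))).mul
          ((continuous_lswEigenfun hκ' k).comp continuous_snd)
      exact hcts.measurable.comp (hτm.prodMk hVm)
    have hsum : ∀ ω, HasSum (fun k ↦ lswInitCoeff κ k *
        Real.exp (-(lswEigenvalue κ k * (t - (((min (s : WithTop ℝ≥0) (sleExitLevel κ n θ ω)).untopA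
          : ℝ≥0) : ℝ)))) * lswEigenfun κ k (stoppedProcess (sleArgLevel κ n θ) (sleExitLevel κ n θ) s ω))
        (g m ω) := by
      intro ω
      have hS := summable_lswTerm hκ' (hmemV m ω) (r := t - (((min (s : WithTop ℝ≥0)
        (sleExitLevel κ n θ ω)).untopA : ℝ≥0) : ℝ)) (by linarith [hτle m ω])
      simp only [hg]
      rw [lswSeries_eq_tsum]
      exact hS.hasSum
    exact (measurable_of_tendsto_metrizable' atTop (fun N ↦ Finset.measurable_sum (Finset.range N)
      fun k _ ↦ hterm k) (tendsto_pi_nhds.2 fun ω ↦ (hsum ω).tendsto_sum_nat)).aestronglyMeasurable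
  -- domination by `1`
  have hbound : ∀ m, ∀ᵐ ω ∂preWienerMeasure, ‖g m ω‖ ≤ (1 : ℝ) := fun m ↦ Eventually.of_forall fun ω ↦ by
    rw [Real.norm_eq_abs]
    exact abs_lswSeries_init_le_one hκ' (hmemV m ω) (by linarith [hτle m ω])
  -- pointwise limit
  have hlim : ∀ᵐ ω ∂preWienerMeasure, Tendsto (fun m ↦ g m ω) atTop (𝓝
      (if (s : WithTop ℝ≥0) < sleLifetime κ θ ω then
          lswHit κ (arg (sleDriving κ) hc θ s ω) (t - s)
        else (sleExitsTop κ θ).indicator (fun ω ↦ lswHit κ (2 * Real.pi) (t - sleLifetimeReal κ θ ω)) ω)) := by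
    filter_upwards [ae_sleLifetime_lt_top (θ := θ) hκ] with ω hT
    by_cases hsT : (s : WithTop ℝ≥0) < sleLifetime κ θ ω
    · -- eventually `σₙ > s`: the observable is constant
      rw [if_pos hsT]
      have hmem := arg_mem_Ioo hc hθ hsT
      rw [lswHit_eq_lswSeries hts ⟨hmem.1.le, hmem.2.le⟩]
      obtain ⟨N₁, hN₁⟩ := eventually_lt_exitLevel hc hsT
      refine tendsto_const_nhds.congr' ?_
      filter_upwards [eventually_ge_atTop N₁] with m hm
      have hlt : (s : WithTop ℝ≥0) < sleExitLevel κ (m + N₀) θ ω := hN₁ (m + N₀) (le_add_right hm)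
      simp only [hg]
      rw [stoppedProcess_eq_of_le hlt.le, min_eq_left hlt.le, WithTop.untopA_eq_untop WithTop.coe_ne_top,
        WithTop.untop_coe, arg_eq_argLevel hc hlt.le]
    · -- `T ≤ s`: exit values and clocks converge
      rw [if_neg hsT]
      push Not at hsT
      obtain ⟨T₀, hT₀⟩ := WithTop.ne_top_iff_exists.1 hT.ne
      have hTreal : sleLifetimeReal κ θ ω = T₀ := sleLifetimeReal_of_eq_coe hT₀.symm
      have hT₀s : (T₀ : ℝ) ≤ s := by
        have : (T₀ : WithTop ℝ≥0) ≤ s := by rw [hT₀]; exact hsT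
        exact_mod_cast this
      -- finite exit times `σₙ = rₙ ≤ s`
      have hfin : ∀ n, ∃ r : ℝ≥0, sleExitLevel κ n θ ω = r ∧ r ≤ s := by
        intro n
        have hlt := exitLevel_lt_lifetime hc hθ hT n
        have hne : sleExitLevel κ n θ ω ≠ ⊤ := (hlt.trans_le le_top).ne
        obtain ⟨r, hr⟩ := WithTop.ne_top_iff_exists.1 hne
        refine ⟨r, hr.symm, ?_⟩
        have : (r : WithTop ℝ≥0) ≤ s := by rw [hr]; exact hlt.le.trans hsT
        exact_mod_cast this
      have hgeq : ∀ m, g m ω = lswSeries κ (lswInitCoeff κ) (sleExitLevelValue κ (m + N₀) θ ω)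
          (t - sleExitLevelReal κ (m + N₀) θ ω) := by
        intro m
        obtain ⟨r, hr, hrs⟩ := hfin (m + N₀)
        simp only [hg]
        rw [stoppedProcess_eq_of_ge (by rw [hr]; exact_mod_cast hrs), untopA_min_of_coe_le s hr hrs,
          sleExitLevelReal_of_eq_coe hr, sleExitLevelValue, hr]
      simp_rw [hgeq]
      have hclock : Tendsto (fun m ↦ t - sleExitLevelReal κ (m + N₀) θ ω) atTop
          (𝓝 (t - sleLifetimeReal κ θ ω)) :=
        tendsto_const_nhds.sub ((tendsto_sleExitLevelReal hT).comp (tendsto_add_atTop_nat N₀))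
      have hclock_ge : ∀ m, t - s ≤ t - sleExitLevelReal κ (m + N₀) θ ω := fun m ↦ by
        obtain ⟨r, hr, hrs⟩ := hfin (m + N₀)
        rw [sleExitLevelReal_of_eq_coe hr]
        have : (r : ℝ) ≤ s := by exact_mod_cast hrs
        linarith
      have htT : 0 < t - sleLifetimeReal κ θ ω := by rw [hTreal]; linarith
      rcases exitsTop_or_exitsBot hc hθ hT with htop | hbot
      · -- top exit: values `2π - 2δₙ → 2π`, joint continuity of `u` at `(2π, t - T)`
        have hmem : ω ∈ sleExitsTop κ θ := htop
        rw [indicator_of_mem hmem, lswHit_eq_lswSeries htT ⟨by positivity, le_rfl⟩]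
        obtain ⟨N, hN⟩ := htop
        have hval : ∀ᶠ m in atTop, sleExitLevelValue κ (m + N₀) θ ω = 2 * Real.pi - 2 * level (m + N₀) := by
          filter_upwards [eventually_ge_atTop N] with m hm
          obtain ⟨r, hr, -⟩ := hfin (m + N₀)
          exact (topAt_iff_sleExitLevelValue hr).1 (hN (m + N₀) (le_add_right hm))
        have hcont := (continuousOn_lswSeries_init_prod hκ') (2 * Real.pi, t - sleLifetimeReal κ θ ω)
          ⟨⟨by positivity, le_rfl⟩, htT⟩
        have hpair : Tendsto (fun m ↦ (2 * Real.pi - 2 * level (m + N₀), t - sleExitLevelReal κ (m + N₀) θ ω))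
            atTop (𝓝[Ioc 0 (2 * Real.pi) ×ˢ Ioi 0] (2 * Real.pi, t - sleLifetimeReal κ θ ω)) := by
          refine tendsto_nhdsWithin_iff.2 ⟨Tendsto.prodMk_nhds ?_ hclock, Eventually.of_forall fun m ↦
            ⟨⟨?_, by linarith [level_pos (m + N₀)]⟩, lt_of_lt_of_le hts (hclock_ge m)⟩⟩
          · have h2 : Tendsto (fun m : ℕ ↦ 2 * Real.pi - 2 * level (m + N₀)) atTop (𝓝 (2 * Real.pi - 2 * 0)) :=
              tendsto_const_nhds.sub ((tendsto_level.comp (tendsto_add_atTop_nat N₀)).const_mul 2)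
            simpa using h2
          · have := level_le_one (m + N₀)
            show 0 < 2 * Real.pi - 2 * level (m + N₀)
            linarith [Real.pi_gt_three]
        have hlim2 := hcont.tendsto.comp hpair
        refine hlim2.congr' ?_
        filter_upwards [hval] with m hm
        simp only [Function.comp_apply, hm]
      · -- bottom exit: values `2δₙ`, `u(2δₙ, ·) → 0`
        have hnmem : ω ∉ sleExitsTop κ θ := fun htop' ↦ not_exitsTop_and_exitsBot hc θ ω ⟨htop', hbot⟩
        rw [indicator_of_notMem hnmem]
        obtain ⟨N, hN⟩ := hbot
        have hval : ∀ᶠ m in atTop, sleExitLevelValue κ (m + N₀) θ ω = 2 * level (m + N₀) := by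
          filter_upwards [eventually_ge_atTop N] with m hm
          obtain ⟨r, hr, -⟩ := hfin (m + N₀)
          exact (botAt_iff_sleExitLevelValue hr).1 (hN (m + N₀) (le_add_right hm))
        have hlev : Tendsto (fun m : ℕ ↦ 2 * level (m + N₀)) atTop (𝓝[>] 0) := by
          refine tendsto_nhdsWithin_iff.2 ⟨?_, Eventually.of_forall fun m ↦ ?_⟩
          · simpa using (tendsto_level.comp (tendsto_add_atTop_nat N₀)).const_mul 2
          · have := level_pos (m + N₀); simp only [mem_Ioi]; positivity
        have hz := (tendsto_lswSeries_zero hκ' (lswInitCoeff_hyp hκ') hts).comp hlev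
        have hmem : ∀ m, 2 * level (m + N₀) ∈ Ioc 0 (2 * Real.pi) := fun m ↦
          ⟨by have := level_pos (m + N₀); positivity,
            by have := level_le_one (m + N₀); linarith [Real.pi_gt_three]⟩
        have h0 : Tendsto (fun m ↦ lswSeries κ (lswInitCoeff κ) (2 * level (m + N₀))
            (t - sleExitLevelReal κ (m + N₀) θ ω)) atTop (𝓝 0) :=
          squeeze_zero (fun m ↦ (lswSeries_init_pos hκ' (hmem m) (hts.trans_le (hclock_ge m))).le)
            (fun m ↦ lswSeries_init_antitone hκ' (hmem m) hts (hclock_ge m)) hz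
        refine h0.congr' ?_
        filter_upwards [hval] with m hm
        rw [hm]
  have hdct := tendsto_integral_of_dominated_convergence _ hmeas (integrable_const (1 : ℝ)) hbound hlim
  exact tendsto_nhds_unique (by simp only [hint]; exact tendsto_const_nhds) hdct

/-! ### Step 3: `s ↑ t` off the atoms of the law of `T` -/

/-- `|lswHit| ≤ 1`. [folklore] -/
theorem abs_lswHit_le_one {κ : ℝ} (hκ : 4 < κ) (θ' r : ℝ) : |lswHit κ θ' r| ≤ 1 := by
  have h := lswHit_mem_Icc' hκ θ' r
  rw [abs_of_nonneg h.1]; exact h.2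

/-- `bottomDatum` is measurable. [folklore] -/
theorem measurable_bottomDatum : Measurable bottomDatum := by
  unfold bottomDatum
  exact Measurable.ite measurableSet_Iic measurable_const measurable_const

/-- The integrand `ω ↦ 1_{s<T} u(Y_s, r)` of Step 2 is a.e. strongly measurable (`r > 0`): it is the
a.e. limit of `1_{s<T} u(Y^{δₙ}_s, r)`, and `θ' ↦ lswHit κ θ' r` is continuous. [folklore] -/
theorem aestronglyMeasurable_indicator_lswHit_arg (hκ : 4 < κ) (s : ℝ≥0) {r : ℝ} (hr : 0 < r) :
    AEStronglyMeasurable (fun ω ↦ {ω | (s : WithTop ℝ≥0) < sleLifetime κ θ ω}.indicator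
      (fun ω ↦ lswHit κ (arg (sleDriving κ) (continuous_sleDriving' κ) θ s ω) r) ω) preWienerMeasure := by
  have hκ' : (4 : ℝ) < κ := by exact_mod_cast hκ
  have hc := continuous_sleDriving' κ
  have hA : MeasurableSet {ω | (s : WithTop ℝ≥0) < sleLifetime κ θ ω} := measurableSet_lt_sleLifetime κ θ s
  refine aestronglyMeasurable_of_tendsto_ae atTop (f := fun (n : ℕ) ω ↦
    {ω | (s : WithTop ℝ≥0) < sleLifetime κ θ ω}.indicator
      (fun ω ↦ lswHit κ (sleArgLevel κ n θ s ω) r) ω) (fun n ↦ ?_) ?_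
  · refine (Measurable.indicator ?_ hA).aestronglyMeasurable
    have hYm : Measurable fun ω ↦ sleArgLevel κ n θ s ω :=
      ((stronglyAdapted_sleArgLevel κ n θ s).measurable).mono (brownianFiltration.le s) le_rfl
    exact (continuous_lswHit_of_pos hκ' hr).measurable.comp hYm
  · filter_upwards [ae_sleLifetime_lt_top (θ := θ) hκ] with ω hT
    by_cases hlt : (s : WithTop ℝ≥0) < sleLifetime κ θ ω
    · have hmem : ω ∈ {ω | (s : WithTop ℝ≥0) < sleLifetime κ θ ω} := hlt
      simp only [indicator_of_mem hmem]
      obtain ⟨N₁, hN₁⟩ := eventually_lt_exitLevel hc hlt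
      refine tendsto_const_nhds.congr' ?_
      filter_upwards [eventually_ge_atTop N₁] with n hn
      rw [arg_eq_argLevel hc (hN₁ n hn).le]
    · have hnmem : ω ∉ {ω | (s : WithTop ℝ≥0) < sleLifetime κ θ ω} := hlt
      simp only [indicator_of_notMem hnmem]
      exact tendsto_const_nhds

/-- The top-exit integrand `ω ↦ 1_{Y_T = 2π} G(t - T)` is measurable (`G = lswHit κ (2π)`). [folklore] -/
theorem measurable_indicator_lswHit_two_pi (hκ : (4 : ℝ) < κ) (t : ℝ) :
    Measurable fun ω ↦ (sleExitsTop κ θ).indicator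
      (fun ω ↦ lswHit κ (2 * Real.pi) (t - sleLifetimeReal κ θ ω)) ω :=
  ((lswHit_two_pi_continuous hκ).measurable.comp (measurable_const.sub (measurable_sleLifetimeReal κ θ))).indicator
    (measurableSet_sleExitsTop κ θ)

/-- The bottom-exit integrand `ω ↦ 1_{Y_T = 0} b(t - T)` is measurable. [folklore] -/
theorem measurable_indicator_bottomDatum (t : ℝ) :
    Measurable fun ω ↦ (sleExitsBot κ θ).indicator (fun ω ↦ bottomDatum (t - sleLifetimeReal κ θ ω)) ω :=
  (measurable_bottomDatum.comp (measurable_const.sub (measurable_sleLifetimeReal κ θ))).indicator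
    (measurableSet_sleExitsBot κ θ)

/-- `botST`/`topST` unfolded at the data `b` and `G`. [folklore] -/
theorem botST_add_topST_eq_integral (hκ : (4 : ℝ) < κ) (θ t : ℝ) :
    botST κ bottomDatum θ t + topST κ (lswHit κ (2 * Real.pi)) θ t =
      ∫ ω, ((sleExitsBot κ θ).indicator (fun ω ↦ bottomDatum (t - sleLifetimeReal κ θ ω)) ω +
        (sleExitsTop κ θ).indicator (fun ω ↦ lswHit κ (2 * Real.pi) (t - sleLifetimeReal κ θ ω)) ω)
      ∂preWienerMeasure := by
  haveI := isProbabilityMeasure_preWienerMeasure'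
  rw [MeasureTheory.integral_add]
  · rfl
  · refine integrable_of_abs_le (measurable_indicator_bottomDatum t) (C := 1) fun ω ↦ ?_
    by_cases hω : ω ∈ sleExitsBot κ θ
    · rw [indicator_of_mem hω]
      have := bottomDatum_mem_Icc (t - sleLifetimeReal κ θ ω)
      rw [abs_of_nonneg this.1]; exact this.2
    · rw [indicator_of_notMem hω, abs_zero]; exact zero_le_one
  · refine integrable_of_abs_le (measurable_indicator_lswHit_two_pi hκ t) (C := 1) fun ω ↦ ?_
    by_cases hω : ω ∈ sleExitsTop κ θ
    · rw [indicator_of_mem hω]; exact abs_lswHit_le_one hκ _ _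
    · rw [indicator_of_notMem hω, abs_zero]; exact zero_le_one

/-- **`u(θ, t) = E^θ[1_{t ≤ T}; Y_T = 0] + E^θ[G(t - T); Y_T = 2π]` for `t > 0` not an atom of the
law of `T`** (`θ ∈ (0, 2π)`, `κ > 4`): the limit `s ↑ t` of `lswSeries_eq_integral_lt_lifetime`
(bounded convergence; on `{t < T}` the flow is continuous at `t` with `Y_t ∈ (0, 2π)` and
`u(Y_s, t - s) → 1` by the interior initial condition; on `{T < t}` the integrand is eventually
constant; `{T = t}` is null), followed by the a.e. identity
`1_{t<T} + 1_{T<t, top} G(t - T) = 1_bot 1_{t ≤ T} + 1_top G(t - T)`. [cite: LawlerSchrammWernerEJP2002, §2 (2.10)] -/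
theorem lswHit_eq_botST_add_topST_of_null (hκ : 4 < κ) (hθ : θ ∈ Ioo 0 (2 * Real.pi)) {t : ℝ}
    (ht : 0 < t) (hnull : preWienerMeasure {ω | sleLifetimeReal κ θ ω = t} = 0) :
    lswHit κ θ t = botST κ bottomDatum θ t + topST κ (lswHit κ (2 * Real.pi)) θ t := by
  haveI := isProbabilityMeasure_preWienerMeasure'
  have hκ' : (4 : ℝ) < κ := by exact_mod_cast hκ
  have hc := continuous_sleDriving' κ
  -- the times `s_j = t (j+1)/(j+2) ↑ t`
  set sr : ℕ → ℝ := fun j ↦ t * ((j : ℝ) + 1) / ((j : ℝ) + 2) with hsr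
  have hsr_pos : ∀ j, 0 < sr j := fun j ↦ by simp only [hsr]; positivity
  have hsr_lt : ∀ j, sr j < t := fun j ↦ by
    simp only [hsr]
    rw [div_lt_iff₀ (by positivity)]; nlinarith
  have hsr_lim : Tendsto sr atTop (𝓝 t) := by
    have h1 : Tendsto (fun j : ℕ ↦ 1 - 1 / ((j : ℝ) + 2)) atTop (𝓝 (1 - 0)) := by
      refine tendsto_const_nhds.sub ?_
      have h := (tendsto_one_div_add_atTop_nhds_zero_nat (𝕜 := ℝ)).comp (tendsto_add_atTop_nat 1)
      refine h.congr fun j ↦ ?_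
      simp only [Function.comp_apply]; push_cast; ring
    rw [sub_zero] at h1
    have h2 := h1.const_mul t
    rw [mul_one] at h2
    refine h2.congr fun j ↦ ?_
    simp only [hsr]; field_simp; ring
  set s : ℕ → ℝ≥0 := fun j ↦ (sr j).toNNReal with hs
  have hs_coe : ∀ j, ((s j : ℝ≥0) : ℝ) = sr j := fun j ↦ Real.coe_toNNReal _ (hsr_pos j).le
  have hs_lt : ∀ j, ((s j : ℝ≥0) : ℝ) < t := fun j ↦ by rw [hs_coe]; exact hsr_lt j
  -- Step 2 at each `s_j`
  set Φ : ℕ → (ℝ≥0 → ℝ) → ℝ := fun j ω ↦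
    if ((s j : ℝ≥0) : WithTop ℝ≥0) < sleLifetime κ θ ω then
      lswHit κ (arg (sleDriving κ) hc θ (s j) ω) (t - s j)
    else (sleExitsTop κ θ).indicator (fun ω ↦ lswHit κ (2 * Real.pi) (t - sleLifetimeReal κ θ ω)) ω
    with hΦ
  have hint : ∀ j, ∫ ω, Φ j ω ∂preWienerMeasure = lswSeries κ (lswInitCoeff κ) θ t := fun j ↦
    (lswSeries_eq_integral_lt_lifetime hκ hθ (hs_lt j)).symm
  -- the limit integrand
  set Ψ : (ℝ≥0 → ℝ) → ℝ := fun ω ↦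
    if ((t.toNNReal : ℝ≥0) : WithTop ℝ≥0) < sleLifetime κ θ ω then 1
    else (sleExitsTop κ θ).indicator (fun ω ↦ lswHit κ (2 * Real.pi) (t - sleLifetimeReal κ θ ω)) ω
    with hΨ
  -- measurability
  have hind := measurable_indicator_lswHit_two_pi (θ := θ) hκ' t
  have hmeasΦ : ∀ j, AEStronglyMeasurable (Φ j) preWienerMeasure := by
    intro j
    have hA : MeasurableSet {ω | ((s j : ℝ≥0) : WithTop ℝ≥0) < sleLifetime κ θ ω} :=
      measurableSet_lt_sleLifetime κ θ (s j)
    have harg := aestronglyMeasurable_indicator_lswHit_arg (θ := θ) hκ (s j) (r := t - s j)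
      (by rw [hs_coe]; linarith [hsr_lt j])
    have heq : Φ j = fun ω ↦ {ω | ((s j : ℝ≥0) : WithTop ℝ≥0) < sleLifetime κ θ ω}.indicator
        (fun ω ↦ lswHit κ (arg (sleDriving κ) hc θ (s j) ω) (t - s j)) ω +
        {ω | ((s j : ℝ≥0) : WithTop ℝ≥0) < sleLifetime κ θ ω}ᶜ.indicator (fun ω ↦ (sleExitsTop κ θ).indicator
          (fun ω ↦ lswHit κ (2 * Real.pi) (t - sleLifetimeReal κ θ ω)) ω) ω := by
      funext ω
      by_cases h : ((s j : ℝ≥0) : WithTop ℝ≥0) < sleLifetime κ θ ω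
      · have hm : ω ∈ {ω | ((s j : ℝ≥0) : WithTop ℝ≥0) < sleLifetime κ θ ω} := h
        simp only [hΦ, if_pos h, indicator_of_mem hm, indicator_of_notMem (notMem_compl_iff.2 hm), add_zero]
      · have hm : ω ∉ {ω | ((s j : ℝ≥0) : WithTop ℝ≥0) < sleLifetime κ θ ω} := h
        simp only [hΦ, if_neg h, indicator_of_notMem hm, indicator_of_mem (mem_compl hm), zero_add]
    rw [heq]
    exact harg.add ((hind.indicator hA.compl).aestronglyMeasurable)
  -- domination by `1`
  have hboundΦ : ∀ j, ∀ᵐ ω ∂preWienerMeasure, ‖Φ j ω‖ ≤ (1 : ℝ) := by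
    intro j
    refine Eventually.of_forall fun ω ↦ ?_
    rw [Real.norm_eq_abs]
    simp only [hΦ]
    split_ifs with h
    · exact abs_lswHit_le_one hκ' _ _
    · by_cases hω : ω ∈ sleExitsTop κ θ
      · rw [indicator_of_mem hω]; exact abs_lswHit_le_one hκ' _ _
      · rw [indicator_of_notMem hω, abs_zero]; exact zero_le_one
  -- pointwise limit `Φ j → Ψ` a.e.
  have haeT : ∀ᵐ ω ∂preWienerMeasure, sleLifetimeReal κ θ ω ≠ t := by
    rw [ae_iff]; simpa only [not_not] using hnull
  have hlim : ∀ᵐ ω ∂preWienerMeasure, Tendsto (fun j ↦ Φ j ω) atTop (𝓝 (Ψ ω)) := by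
    filter_upwards [ae_sleLifetime_lt_top (θ := θ) hκ, haeT] with ω hT hTt
    obtain ⟨T₀, hT₀⟩ := WithTop.ne_top_iff_exists.1 hT.ne
    have hTreal : sleLifetimeReal κ θ ω = T₀ := sleLifetimeReal_of_eq_coe hT₀.symm
    rcases lt_or_gt_of_ne hTt with hTlt | hTgt
    · -- `T < t`: eventually `s_j > T`, the integrand is constant
      have hnot : ¬ ((t.toNNReal : ℝ≥0) : WithTop ℝ≥0) < sleLifetime κ θ ω := by
        rw [← hT₀, WithTop.coe_lt_coe, not_lt, ← NNReal.coe_le_coe, Real.coe_toNNReal _ ht.le, ← hTreal]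
        exact hTlt.le
      simp only [hΨ, if_neg hnot]
      have hev : ∀ᶠ j in atTop, ¬ ((s j : ℝ≥0) : WithTop ℝ≥0) < sleLifetime κ θ ω := by
        have h1 : ∀ᶠ j in atTop, sleLifetimeReal κ θ ω < sr j := hsr_lim (Ioi_mem_nhds hTlt)
        filter_upwards [h1] with j hj
        rw [← hT₀, WithTop.coe_lt_coe, not_lt, ← NNReal.coe_le_coe, hs_coe, ← hTreal]
        exact hj.le
      refine tendsto_const_nhds.congr' ?_
      filter_upwards [hev] with j hj
      simp only [hΦ, if_neg hj]
    · -- `t < T`: the flow is continuous at `t`, `Y_t ∈ (0, 2π)`, and `u(Y_{s_j}, t - s_j) → 1`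
      have htT : ((t.toNNReal : ℝ≥0) : WithTop ℝ≥0) < sleLifetime κ θ ω := by
        rw [← hT₀, WithTop.coe_lt_coe, ← NNReal.coe_lt_coe, Real.coe_toNNReal _ ht.le, ← hTreal]
        exact hTgt
      simp only [hΨ, if_pos htT]
      have hsT : ∀ j, ((s j : ℝ≥0) : WithTop ℝ≥0) < sleLifetime κ θ ω := fun j ↦
        lt_of_le_of_lt (WithTop.coe_le_coe.2 (by
          rw [← NNReal.coe_le_coe, hs_coe, Real.coe_toNNReal _ ht.le]; exact (hsr_lt j).le)) htT
      have hΦeq : ∀ j, Φ j ω = lswHit κ (arg (sleDriving κ) hc θ (s j) ω) (t - s j) :=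
        fun j ↦ by simp only [hΦ, if_pos (hsT j)]
      simp_rw [hΦeq]
      -- continuity of the flow at `t`
      obtain ⟨N, hN⟩ := eventually_lt_exitLevel hc htT
      have hcont : ContinuousOn (fun r ↦ arg (sleDriving κ) hc θ r ω) (Iic t.toNNReal) :=
        continuousOn_arg hc (hN N le_rfl).le
      set y₀ := arg (sleDriving κ) hc θ t.toNNReal ω with hy₀
      have hy₀mem : y₀ ∈ Ioo 0 (2 * Real.pi) := arg_mem_Ioo hc hθ htT
      have hs_tend : Tendsto s atTop (𝓝[Iic t.toNNReal] t.toNNReal) := by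
        refine tendsto_nhdsWithin_iff.2 ⟨?_, Eventually.of_forall fun j ↦ ?_⟩
        · exact (continuous_real_toNNReal.tendsto t).comp hsr_lim
        · simp only [mem_Iic, hs]
          exact Real.toNNReal_le_toNNReal (hsr_lt j).le
      have hy : Tendsto (fun j ↦ arg (sleDriving κ) hc θ (s j) ω) atTop (𝓝 y₀) :=
        ((hcont t.toNNReal self_mem_Iic).tendsto).comp hs_tend
      -- `u(y_j, t - s_j) → 1`
      rw [Metric.tendsto_atTop]
      intro η hη
      have hθ₀ : y₀ / 2 ∈ Ioc 0 (2 * Real.pi) :=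
        ⟨by linarith [hy₀mem.1], by linarith [hy₀mem.2, Real.pi_pos]⟩
      obtain ⟨t₀, ht₀, hclose⟩ := lswSeries_init_tendsto_one hκ' hθ₀ (half_pos hη)
      have hev1 : ∀ᶠ j in atTop, y₀ / 2 < arg (sleDriving κ) hc θ (s j) ω :=
        hy (Ioi_mem_nhds (by linarith [hy₀mem.1]))
      have hev2 : ∀ᶠ j in atTop, t - sr j < t₀ := by
        have : Tendsto (fun j ↦ t - sr j) atTop (𝓝 (t - t)) := tendsto_const_nhds.sub hsr_lim
        rw [sub_self] at this
        exact this (Iio_mem_nhds ht₀)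
      obtain ⟨J, hJ⟩ := (hev1.and hev2).exists_forall_of_atTop
      refine ⟨J, fun j hj ↦ ?_⟩
      obtain ⟨h1, h2⟩ := hJ j hj
      have hmemj := arg_mem_Ioo hc hθ (hsT j)
      have htsj : 0 < t - s j := by rw [hs_coe]; linarith [hsr_lt j]
      have := hclose (t - s j) ⟨htsj, by rw [hs_coe]; exact h2⟩
        (arg (sleDriving κ) hc θ (s j) ω) ⟨h1.le, hmemj.2.le⟩
      rw [Real.dist_eq, lswHit_eq_lswSeries htsj ⟨hmemj.1.le, hmemj.2.le⟩]
      exact this.trans_lt (half_lt_self hη)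
  -- bounded convergence
  have hdct := tendsto_integral_of_dominated_convergence _ hmeasΦ (integrable_const (1 : ℝ)) hboundΦ hlim
  have hΨint : ∫ ω, Ψ ω ∂preWienerMeasure = lswSeries κ (lswInitCoeff κ) θ t :=
    tendsto_nhds_unique hdct (by simp only [hint]; exact tendsto_const_nhds)
  -- `Ψ = 1_bot b(t - T) + 1_top G(t - T)` a.e.
  have hae : ∀ᵐ ω ∂preWienerMeasure, Ψ ω =
      (sleExitsBot κ θ).indicator (fun ω ↦ bottomDatum (t - sleLifetimeReal κ θ ω)) ω +
      (sleExitsTop κ θ).indicator (fun ω ↦ lswHit κ (2 * Real.pi) (t - sleLifetimeReal κ θ ω)) ω := by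
    filter_upwards [ae_sleLifetime_lt_top (θ := θ) hκ, ae_mem_sleExitsTop_or_sleExitsBot hκ hθ, haeT]
      with ω hT hside hTt
    obtain ⟨T₀, hT₀⟩ := WithTop.ne_top_iff_exists.1 hT.ne
    have hTreal : sleLifetimeReal κ θ ω = T₀ := sleLifetimeReal_of_eq_coe hT₀.symm
    by_cases htT : ((t.toNNReal : ℝ≥0) : WithTop ℝ≥0) < sleLifetime κ θ ω
    · -- `t < T`: both data equal `1`, and exactly one side indicator is `1`
      simp only [hΨ, if_pos htT]
      have htT' : t < sleLifetimeReal κ θ ω := by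
        rw [← hT₀, WithTop.coe_lt_coe, ← NNReal.coe_lt_coe, Real.coe_toNNReal _ ht.le] at htT
        rwa [hTreal]
      have hb : bottomDatum (t - sleLifetimeReal κ θ ω) = 1 := by
        rw [bottomDatum, if_pos (by linarith)]
      have hG : lswHit κ (2 * Real.pi) (t - sleLifetimeReal κ θ ω) = 1 := by
        rw [lswHit, if_pos (by linarith)]
      rcases hside with htop | hbot
      · have hnb : ω ∉ sleExitsBot κ θ := fun hb' ↦ not_exitsTop_and_exitsBot hc θ ω ⟨htop, hb'⟩
        rw [indicator_of_mem htop, indicator_of_notMem hnb, hG, zero_add]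
      · have hnt : ω ∉ sleExitsTop κ θ := fun ht' ↦ not_exitsTop_and_exitsBot hc θ ω ⟨ht', hbot⟩
        rw [indicator_of_mem hbot, indicator_of_notMem hnt, hb, add_zero]
    · -- `T < t` (the case `T = t` is excluded): the bottom datum vanishes
      simp only [hΨ, if_neg htT]
      have hTle : sleLifetimeReal κ θ ω ≤ t := by
        rw [← hT₀, WithTop.coe_lt_coe, not_lt, ← NNReal.coe_le_coe, Real.coe_toNNReal _ ht.le] at htT
        rwa [hTreal]
      have hlt : sleLifetimeReal κ θ ω < t := lt_of_le_of_ne hTle hTt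
      have hb : bottomDatum (t - sleLifetimeReal κ θ ω) = 0 := by
        rw [bottomDatum, if_neg (by linarith)]
      by_cases hω : ω ∈ sleExitsBot κ θ
      · rw [indicator_of_mem hω, hb, zero_add]
      · rw [indicator_of_notMem hω, zero_add]
  -- conclude
  rw [lswHit_eq_lswSeries ht ⟨hθ.1.le, hθ.2.le⟩, ← hΨint, integral_congr_ae hae,
    botST_add_topST_eq_integral hκ']

/-! ### Step 4: all times -/

/-- **The law of `T` has at most countably many atoms.** [folklore] -/
theorem countable_atoms_sleLifetimeReal (κ : ℝ≥0) (θ : ℝ) :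
    {t : ℝ | 0 < preWienerMeasure {ω | sleLifetimeReal κ θ ω = t}}.Countable :=
  Measure.countable_meas_pos_of_disjoint_iUnion (μ := preWienerMeasure)
    (fun t ↦ (measurable_sleLifetimeReal κ θ) (measurableSet_singleton t))
    fun t t' htt' ↦ Set.disjoint_left.2 fun ω (h : sleLifetimeReal κ θ ω = t)
      (h' : sleLifetimeReal κ θ ω = t') ↦ htt' (h.symm.trans h')

/-- **The identity for `t ≤ 0`**: `u = 1`, and `b(t - T) = G(t - T) = 1` while
`P[Y_T = 0] + P[Y_T = 2π] = 1`. [folklore] -/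
theorem lswHit_eq_botST_add_topST_of_nonpos (hκ : 4 < κ) (hθ : θ ∈ Ioo 0 (2 * Real.pi)) {t : ℝ}
    (ht : t ≤ 0) :
    lswHit κ θ t = botST κ bottomDatum θ t + topST κ (lswHit κ (2 * Real.pi)) θ t := by
  haveI := isProbabilityMeasure_preWienerMeasure'
  have hκ' : (4 : ℝ) < κ := by exact_mod_cast hκ
  rw [botST_add_topST_eq_integral hκ', lswHit, if_pos ht]
  have heq : ∀ ω, (sleExitsBot κ θ).indicator (fun ω ↦ bottomDatum (t - sleLifetimeReal κ θ ω)) ω +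
      (sleExitsTop κ θ).indicator (fun ω ↦ lswHit κ (2 * Real.pi) (t - sleLifetimeReal κ θ ω)) ω =
      ((sleExitsBot κ θ).indicator (fun _ ↦ (1 : ℝ)) ω + (sleExitsTop κ θ).indicator (fun _ ↦ (1 : ℝ)) ω) := by
    intro ω
    have hT0 := sleLifetimeReal_nonneg κ θ ω
    have hb : bottomDatum (t - sleLifetimeReal κ θ ω) = 1 := by rw [bottomDatum, if_pos (by linarith)]
    have hG : lswHit κ (2 * Real.pi) (t - sleLifetimeReal κ θ ω) = 1 := by rw [lswHit, if_pos (by linarith)]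
    congr 1
    · by_cases hω : ω ∈ sleExitsBot κ θ
      · rw [indicator_of_mem hω, indicator_of_mem hω, hb]
      · rw [indicator_of_notMem hω, indicator_of_notMem hω]
    · by_cases hω : ω ∈ sleExitsTop κ θ
      · rw [indicator_of_mem hω, indicator_of_mem hω, hG]
      · rw [indicator_of_notMem hω, indicator_of_notMem hω]
  simp_rw [heq]
  rw [MeasureTheory.integral_add ((integrable_const (1 : ℝ)).indicator (measurableSet_sleExitsBot κ θ))
    ((integrable_const (1 : ℝ)).indicator (measurableSet_sleExitsTop κ θ)),
    integral_indicator_const _ (measurableSet_sleExitsBot κ θ),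
    integral_indicator_const _ (measurableSet_sleExitsTop κ θ), smul_eq_mul, mul_one, smul_eq_mul, mul_one,
    add_comm, measureReal_sleExitsTop_add_sleExitsBot hκ hθ]

/-- `r ↦ lswHit κ θ r` is continuous at every `t > 0` (`θ ∈ [0, 2π]`). [folklore] -/
theorem continuousAt_lswHit {κ : ℝ} (hκ : 4 < κ) (hθ : θ ∈ Ioo 0 (2 * Real.pi)) {t : ℝ} (ht : 0 < t) :
    ContinuousAt (fun r ↦ lswHit κ θ r) t := by
  have hθ' : θ ∈ Ioc 0 (2 * Real.pi) := ⟨hθ.1, hθ.2.le⟩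
  have hc := (continuousOn_lswSeries_init_t' hκ hθ').continuousAt (Ioi_mem_nhds ht)
  refine hc.congr ?_
  filter_upwards [Ioi_mem_nhds ht] with r hr
  exact (lswHit_eq_lswSeries hr ⟨hθ.1.le, hθ.2.le⟩).symm

/-- **LSW's renewal identity (2.10) for the series solution**: for `κ > 4`, `θ ∈ (0, 2π)` and every
real `t`,

  `u(θ, t) = E^θ[1_{t ≤ T}; Y_T = 0] + E^θ[u(2π, t - T); Y_T = 2π]`,

i.e. `lswHit κ θ t = botST κ bottomDatum θ t + topST κ (lswHit κ (2π)) θ t` — "`h(θ, t) = E[h(Y_T^θ, t - T)]`,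
where we use the fact that `h(θ, t) = 1` for `t ≤ 0`" (LSW p. 6), for the explicit solution `u`
(`h(0, s) = 0` for `s > 0`). Off the atoms of `T` this is `lswHit_eq_botST_add_topST_of_null`; an
atom `t > 0` is approached from the left by non-atomic times, along which both sides converge
(`u(θ, ·)` is continuous; bounded convergence on the right, `G` being continuous and
`1_{t_j ≤ T} → 1_{t ≤ T}` for `t_j ↑ t`). [cite: LawlerSchrammWernerEJP2002, §2 (2.10)] -/
theorem lswHit_eq_botST_add_topST (hκ : 4 < κ) (hθ : θ ∈ Ioo 0 (2 * Real.pi)) (t : ℝ) :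
    lswHit κ θ t = botST κ bottomDatum θ t + topST κ (lswHit κ (2 * Real.pi)) θ t := by
  haveI := isProbabilityMeasure_preWienerMeasure'
  have hκ' : (4 : ℝ) < κ := by exact_mod_cast hκ
  rcases le_or_gt t 0 with ht | ht
  · exact lswHit_eq_botST_add_topST_of_nonpos hκ hθ ht
  -- non-atomic times `t_j ↑ t`
  set S : Set ℝ := {r | 0 < preWienerMeasure {ω | sleLifetimeReal κ θ ω = r}} with hS
  have hdense : Dense Sᶜ := (countable_atoms_sleLifetimeReal κ θ).dense_compl ℝ
  have hex : ∀ j : ℕ, ∃ r, r ∈ Sᶜ ∧ r ∈ Ioo (max (t - 1 / ((j : ℝ) + 1)) (t / 2)) t := by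
    intro j
    have hlt : max (t - 1 / ((j : ℝ) + 1)) (t / 2) < t :=
      max_lt (sub_lt_self t (by positivity)) (by linarith)
    obtain ⟨r, hr1, hr2⟩ := hdense.exists_mem_open isOpen_Ioo (nonempty_Ioo.2 hlt)
    exact ⟨r, hr1, hr2⟩
  choose tj htjS htjI using hex
  have htj_pos : ∀ j, 0 < tj j := fun j ↦ by
    have := (htjI j).1; have h2 := le_max_right (t - 1 / ((j : ℝ) + 1)) (t / 2); linarith
  have htj_lt : ∀ j, tj j < t := fun j ↦ (htjI j).2
  have htj_lim : Tendsto tj atTop (𝓝 t) := by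
    have hlow : Tendsto (fun j : ℕ ↦ t - 1 / ((j : ℝ) + 1)) atTop (𝓝 (t - 0)) :=
      tendsto_const_nhds.sub (tendsto_one_div_add_atTop_nhds_zero_nat (𝕜 := ℝ))
    rw [sub_zero] at hlow
    refine tendsto_of_tendsto_of_tendsto_of_le_of_le hlow tendsto_const_nhds (fun j ↦ ?_) fun j ↦ (htj_lt j).le
    exact ((le_max_left _ _).trans_lt (htjI j).1).le
  have hnull : ∀ j, preWienerMeasure {ω | sleLifetimeReal κ θ ω = tj j} = 0 := fun j ↦ by
    have h := htjS j
    simp only [hS, mem_compl_iff, mem_setOf_eq, not_lt] at h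
    exact le_antisymm h bot_le
  have hid : ∀ j, lswHit κ θ (tj j) = botST κ bottomDatum θ (tj j) + topST κ (lswHit κ (2 * Real.pi)) θ (tj j) :=
    fun j ↦ lswHit_eq_botST_add_topST_of_null hκ hθ (htj_pos j) (hnull j)
  -- left-hand side
  have hL : Tendsto (fun j ↦ lswHit κ θ (tj j)) atTop (𝓝 (lswHit κ θ t)) :=
    ((continuousAt_lswHit hκ' hθ ht).tendsto).comp htj_lim
  -- right-hand side by bounded convergence
  set F : ℕ → (ℝ≥0 → ℝ) → ℝ := fun j ω ↦
    (sleExitsBot κ θ).indicator (fun ω ↦ bottomDatum (tj j - sleLifetimeReal κ θ ω)) ω +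
    (sleExitsTop κ θ).indicator (fun ω ↦ lswHit κ (2 * Real.pi) (tj j - sleLifetimeReal κ θ ω)) ω with hF
  have hFm : ∀ j, AEStronglyMeasurable (F j) preWienerMeasure := fun j ↦
    ((measurable_indicator_bottomDatum (tj j)).add (measurable_indicator_lswHit_two_pi hκ' (tj j))).aestronglyMeasurable
  have hFb : ∀ j, ∀ᵐ ω ∂preWienerMeasure, ‖F j ω‖ ≤ (2 : ℝ) := fun j ↦ Eventually.of_forall fun ω ↦ by
    rw [Real.norm_eq_abs]
    have h1 : |(sleExitsBot κ θ).indicator (fun ω ↦ bottomDatum (tj j - sleLifetimeReal κ θ ω)) ω| ≤ 1 := by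
      by_cases hω : ω ∈ sleExitsBot κ θ
      · rw [indicator_of_mem hω]
        have := bottomDatum_mem_Icc (tj j - sleLifetimeReal κ θ ω)
        rw [abs_of_nonneg this.1]; exact this.2
      · rw [indicator_of_notMem hω, abs_zero]; exact zero_le_one
    have h2 : |(sleExitsTop κ θ).indicator (fun ω ↦ lswHit κ (2 * Real.pi) (tj j - sleLifetimeReal κ θ ω)) ω| ≤ 1 := by
      by_cases hω : ω ∈ sleExitsTop κ θ
      · rw [indicator_of_mem hω]; exact abs_lswHit_le_one hκ' _ _
      · rw [indicator_of_notMem hω, abs_zero]; exact zero_le_one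
    exact (abs_add_le _ _).trans (by linarith)
  have hFlim : ∀ᵐ ω ∂preWienerMeasure, Tendsto (fun j ↦ F j ω) atTop (𝓝
      ((sleExitsBot κ θ).indicator (fun ω ↦ bottomDatum (t - sleLifetimeReal κ θ ω)) ω +
        (sleExitsTop κ θ).indicator (fun ω ↦ lswHit κ (2 * Real.pi) (t - sleLifetimeReal κ θ ω)) ω)) := by
    refine Eventually.of_forall fun ω ↦ Tendsto.add ?_ ?_
    · -- bottom datum: `1_{t_j ≤ T} → 1_{t ≤ T}` (eventually constant)
      by_cases hω : ω ∈ sleExitsBot κ θ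
      · simp only [indicator_of_mem hω]
        rcases le_or_gt t (sleLifetimeReal κ θ ω) with hle | hlt
        · have hb : bottomDatum (t - sleLifetimeReal κ θ ω) = 1 := by rw [bottomDatum, if_pos (by linarith)]
          have hbj : ∀ j, bottomDatum (tj j - sleLifetimeReal κ θ ω) = 1 := fun j ↦ by
            rw [bottomDatum, if_pos (by linarith [htj_lt j])]
          simp only [hb, hbj]
          exact tendsto_const_nhds
        · have hb : bottomDatum (t - sleLifetimeReal κ θ ω) = 0 := by rw [bottomDatum, if_neg (by linarith)]
          have hev : ∀ᶠ j in atTop, bottomDatum (tj j - sleLifetimeReal κ θ ω) = 0 := by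
            filter_upwards [htj_lim (Ioi_mem_nhds hlt)] with j hj
            have hj' : sleLifetimeReal κ θ ω < tj j := hj
            rw [bottomDatum, if_neg (by linarith)]
          rw [hb]
          exact tendsto_const_nhds.congr' (hev.mono fun j hj ↦ hj.symm)
      · simp only [indicator_of_notMem hω]; exact tendsto_const_nhds
    · -- top datum: continuity of `G`
      by_cases hω : ω ∈ sleExitsTop κ θ
      · simp only [indicator_of_mem hω]
        exact ((lswHit_two_pi_continuous hκ').tendsto _).comp (htj_lim.sub_const _)
      · simp only [indicator_of_notMem hω]; exact tendsto_const_nhds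
  have hR := tendsto_integral_of_dominated_convergence _ hFm (integrable_const (2 : ℝ)) hFb hFlim
  have hR' : Tendsto (fun j ↦ botST κ bottomDatum θ (tj j) + topST κ (lswHit κ (2 * Real.pi)) θ (tj j)) atTop
      (𝓝 (botST κ bottomDatum θ t + topST κ (lswHit κ (2 * Real.pi)) θ t)) := by
    rw [botST_add_topST_eq_integral hκ']
    refine hR.congr fun j ↦ ?_
    rw [botST_add_topST_eq_integral hκ']
  exact tendsto_nhds_unique hL (hR'.congr fun j ↦ (hid j).symm)

/-- **The series solution is the renewal extension of its own trace**: for `κ > 4`,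
`θ ∈ [0, 2π]` and every real `t`,
`lswHit κ θ t = renewalST κ bottomDatum (lswHit κ (2π)) θ t` — inside the strip by
`lswHit_eq_botST_add_topST`, at `θ = 0` both sides are `1_{t ≤ 0}` (`u(0, t) = 0` for `t > 0`), at
`θ = 2π` both are the trace. [cite: LawlerSchrammWernerEJP2002, §2 (2.10)] -/
theorem lswHit_eq_renewalST (hκ : 4 < κ) (hθ : θ ∈ Icc 0 (2 * Real.pi)) (t : ℝ) :
    lswHit κ θ t = renewalST κ bottomDatum (lswHit κ (2 * Real.pi)) θ t := by
  have hκ' : (4 : ℝ) < κ := by exact_mod_cast hκ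
  rcases hθ.1.eq_or_lt with h0 | h0
  · rw [← h0, renewalST_zero, lswHit, bottomDatum]
    split_ifs with ht
    · rfl
    · rw [clampTwoPi_of_mem ⟨le_rfl, by positivity⟩, lswSeries_init_zero hκ']
  rcases hθ.2.lt_or_eq with h2 | h2
  · rw [renewalST_of_mem κ _ _ ⟨h0, h2⟩]
    exact lswHit_eq_botST_add_topST hκ ⟨h0, h2⟩ t
  · rw [h2, renewalST_two_pi]

/-- **`κ = 6`**: `lswHit 6 θ t = renewalST 6 bottomDatum (lswHit 6 (2π)) θ t` on `[0, 2π] × ℝ` — the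
datum `(h, h_θ, h_θθ, h_t)` of `isHittingPDEData_lswHit` is the renewal extension of its trace
`t ↦ lswHit 6 (2π) t`. [cite: LawlerSchrammWernerEJP2002, §2 (2.10), Lemma 2.2] -/
theorem lswHit_six_eq_renewalST (hθ : θ ∈ Icc 0 (2 * Real.pi)) (t : ℝ) :
    lswHit 6 θ t = renewalST 6 bottomDatum (lswHit 6 (2 * Real.pi)) θ t := by
  have h := lswHit_eq_renewalST (κ := 6) (by norm_num) hθ t
  simpa using h

end Literature.Probability.Percolation
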